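import Literature.NumberTheory.LFunctions.Zhang2022.Section17Lemma171
import Literature.NumberTheory.LFunctions.Zhang2022.Section3Lemma36Input
import HarnessLib

/-!
# Zhang (2022), Lemma 5.7: `L′(1,χ) ≫ D/φ(D)` under (A) (hence `𝔞 ≫ 1`), kernel-checked

Topic `Literature/NumberTheory/LFunctions/Zhang2022` (Landau–Siegel autopsy tree; verdict-neutral).
Y. Zhang, *Discrete mean estimates and the Landau–Siegel zero*, arXiv:2211.02515v1 (2022) — **an
unrefereed manuscript, a claimed result under adjudication** — §5, Lemma 5.7 (p. 11):

> **Lemma 5.7.** We have `L′(1,χ) ≫ D/φ(D)`.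
> *Proof.* The right side of the equality
> `(1/2πi)∫_{(1)} ζ(1+s)L(1+s,χ) D^{4s}ω₁(s)/s ds = ∑_n ν(n)/n g(D⁴/n)`
> is `≫ ∑_{n∣D} 1/n ≫ D/φ(D)`, since `ν(n) = 1` if `n ∣ D`, while the left side is, by moving the
> line of integration to the left appropriately and applying (A), equal to `L′(1,χ) + o(1)`. □

(`χ` the real primitive character mod `D`, `𝓛 = log D`, `ν = 1 ∗ χ`, (A): `L(1,χ) < 𝓛^{-2022}`; the
lemma is quoted in §2 as "(A) implies `𝔞 ≫ 1` (see Lemma 5.7)", `𝔞 = (6/π²)L′(1,χ)²∏_{q∣D}q/(q+1)`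
of (2.31), and feeds Lemma 5.8 and the endgame of §2.)

This file PROVES the lemma with explicit constants and threshold, by the printed argument with the
weight `e^{-n/X}`, `X = D⁴`, in place of the Gaussian `g(D⁴/n)` (the machine of the tree's
`Section3Lemma31.lean` / `Section17Lemma171.lean`):

* `re_W_nu_ge` (the lower bound): every `ν(n)` is real and `≥ 0` (`divisorSumChar_re_nonneg`:
  multiplicativity and `ν(pᵏ) ∈ {k+1, 0 or 1, 1}`), and `ν(n) = 1` for `n ∣ D`
  (`divisorSumChar_of_dvd`), so `Re ∑ ν(n)e^{-n/D⁴}/n ≥ e^{-1} ∑_{n∣D} 1/n`;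
* `W_eq_residue_add` (the left side): `∑ ν(n) n^{-s} = ζ(s)L(s,χ)` (`LSeries_divisorSumChar`),
  Mellin on `re z = 2`, and the shift to `re z = −1/4` across the DOUBLE pole at `z = 0`
  (`Literature.Analysis.Complex.integral_vertical_sub_eq_sum_of_poles_dslope`), whose residue is
  `L′(1,χ) + u′(0)L(1,χ)` with `u(z) = ζ₁(1+z)Γ(z+1)X^z` (`residue_eq`), `|u′(0)| ≤ 4𝓛·M₁` by
  Cauchy's estimate — so "applying (A)" it is `L′(1,χ) + O(𝓛^{-2021})`; the new line is
  `O(D^{-1/2}(1+𝓛)²)` by the tree's Pólya–Vinogradov-strength bound;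
* `lemma_5_7_divisors`: for `log D ≥ L₀`, `L′(1,χ) ≥ (2e)^{-1} ∑_{n∣D} 1/n`; `lemma_5_7` (the printed
  form): `L′(1,χ) ≥ (4e)^{-1} D/φ(D)` (`∑_{n∣D}1/n ≥ ∏_{p∣D}(1+1/p)` and
  `∏_{p∣D}(1−p^{-2}) ≥ ∏_{2≤n≤D}(1−n^{-2}) = (D+1)/(2D) ≥ 1/2`); and `frakA_ge` (**`𝔞 ≫ 1`**):
  `𝔞 ≥ 3/(2e²π²)`.

Only definitions of the manuscript are used; nothing about its Theorems 1–2 is stated or implied;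
the cell's verdict (the located failure of (8.24)) is independent of this lemma (STEPS row L5.7,
"shown" by hand three times; this file makes it kernel-checked).

## References

* Y. Zhang, arXiv:2211.02515v1 (2022), §5 Lemma 5.7, §2 (2.31). [cite: Zhang2022LandauSiegel, §5, Lemma 5.7]
-/

noncomputable section

open Complex Filter Topology Set MeasureTheory Real Metric ArithmeticFunction
open scoped LSeries.notation

namespace Literature.NumberTheory.LFunctions.Zhang2022.Lemma57

open Literature.NumberTheory.LFunctions.DivisorSumCharSq (W W_eq_tsum
  integral_Gamma_cpow_LSeries_eq integrable_Gamma_cpow_LSeries rpow_le_rpow_add Zconst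
  Zconst_nonneg norm_LFunction_one_add_le)
open Literature.NumberTheory.LFunctions.Zhang2022.Lemma31 (W_ofReal summable_mul_exp_div
  norm_LFunction_le_near_one norm_deriv_LFunction_le_near_one
  ne_one_of_isPrimitive divisorSumChar_im_eq_zero eight_lt_exp_three aux_logpow)
open Literature.NumberTheory.LFunctions.Zhang2022 (nuOf nuOf_apply_prime_pow)
open Literature.NumberTheory.LFunctions.Zhang2022.Lemma171 (isOpen_U)
open Literature.NumberTheory.LFunctions.Zhang2022.Lemma36Input (reChar_mul_all nuOf_reChar_eq)
open Literature.NumberTheory.LFunctions.DirichletAbel (reChar reChar_one reChar_trichotomy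
  isMultiplicative_reChar)
open Literature.NumberTheory.LFunctions.ZetaM4 (CΓ CΓ_pos norm_Gamma_strip_le
  integrable_pow_mul_exp integral_pow_mul_exp_le exists_pow_mul_exp_le)

variable {D : ℕ} [NeZero D] (χ : DirichletCharacter ℂ D)

/-! ### §1. The objects -/

variable (X : ℝ)

/-- `u(z) = ζ₁(1+z) Γ(z+1) X^z` (`ζ₁(w) = (w−1)ζ(w)`, Mathlib's `riemannZeta₁`). [folklore] -/
def u1 (z : ℂ) : ℂ := riemannZeta₁ (1 + z) * Complex.Gamma (z + 1) * (X : ℂ) ^ z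

/-- The regularised numerator `h(z) = ζ₁(1+z) Γ(z+1) X^z L(1+z,χ)`. [folklore] -/
def h1 (z : ℂ) : ℂ := u1 X z * χ.LFunction (1 + z)

/-- The integrand `F(z) = ζ(1+z) Γ(z) X^z L(1+z,χ)` (the source's `ζ(1+s)L(1+s,χ)D^{4s}ω₁(s)/s`
with `Γ(s)X^s` for `D^{4s}ω₁(s)/s`). [cite: Zhang2022LandauSiegel, §5, proof of Lemma 5.7] -/
def F1 (z : ℂ) : ℂ := riemannZeta (1 + z) * Complex.Gamma z * (X : ℂ) ^ z * χ.LFunction (1 + z)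

variable {X}

/-- `u(0) = 1`. [folklore] -/
theorem u1_zero : u1 X 0 = 1 := by
  simp [u1, riemannZeta₁_one, Complex.Gamma_one, cpow_zero]

/-- Off `z = 0` (and off the poles of `Γ`), `F(z) = h(z)/z²`. [folklore] -/
theorem F1_eq_h1_div {z : ℂ} (hz : z ≠ 0) (hz' : ∀ m : ℕ, z ≠ -(m : ℂ)) :
    F1 χ X z = h1 χ X z / (z - 0) ^ (1 + 1) := by
  have hne : (1 : ℂ) + z ≠ 1 := by intro h; exact hz (by linear_combination h)
  rw [F1, h1, u1, LFunctions.riemannZeta₁_eq_mul hne, Complex.Gamma_add_one _ hz,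
    sub_zero, add_sub_cancel_left]
  have := hz' 0
  field_simp
  ring

/-- **The source's definition of `ν`**: `∑ ν(n) n^{-s} = ζ(s) L(s,χ)` for `re s > 1`
(`ν = 1 ∗ χ`; Mathlib's `LSeries_convolution'`). [cite: Zhang2022LandauSiegel, §3 p. 7] -/
theorem LSeries_divisorSumChar {s : ℂ} (hs : 1 < s.re) :
    L (fun n => divisorSumChar χ n) s = riemannZeta s * χ.LFunction s := by
  have hfun : (fun n => divisorSumChar χ n) = ((fun n : ℕ => χ (n : ZMod D)) ⍟ (1 : ℕ → ℂ)) := by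
    funext n
    rw [LSeries.convolution_def, divisorSumChar_apply]
    simp only [Pi.one_apply, mul_one]
    exact (Nat.sum_divisorsAntidiagonal (fun i _ => χ (i : ZMod D)) (n := n)).symm
  rw [hfun, LSeries_convolution' (DirichletCharacter.LSeriesSummable_of_one_lt_re χ hs)
    (LSeriesSummable_one_iff.mpr hs), LSeries_one_eq_riemannZeta hs,
    DirichletCharacter.LFunction_eq_LSeries χ hs, mul_comm]

/-- On `re z > 0`, `F(z) = Γ(z) X^z L(ν, 1+z)`. [cite: Zhang2022LandauSiegel, §5, proof of Lemma 5.7] -/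
theorem F1_eq_of_pos {z : ℂ} (hz : 0 < z.re) :
    F1 χ X z = Complex.Gamma z * (X : ℂ) ^ z * L (fun n => divisorSumChar χ n) (1 + z) := by
  rw [F1, LSeries_divisorSumChar χ (by simp; linarith)]
  ring

omit [NeZero D] in
/-- `u` is differentiable on `re z > −1/2` (for `X > 0`). [folklore] -/
theorem differentiableOn_u1 (hX : 0 < X) : DifferentiableOn ℂ (u1 X) {z : ℂ | -(1 / 2) < z.re} := by
  intro z hz
  have hz' : -(1 / 2) < z.re := hz
  refine DifferentiableAt.differentiableWithinAt ?_
  refine DifferentiableAt.mul (DifferentiableAt.mul ?_ ?_) ?_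
  · exact (differentiable_riemannZeta₁.comp ((differentiable_const (1 : ℂ)).add differentiable_id)) z
  · refine (Complex.differentiableAt_Gamma _ fun m hm => ?_).comp z (differentiableAt_id.add_const 1)
    have := congrArg Complex.re hm
    simp at this
    have h0 : (0 : ℝ) ≤ m := Nat.cast_nonneg m
    linarith
  · exact differentiableAt_id.const_cpow (Or.inl (ofReal_ne_zero.2 hX.ne'))

/-- `z ↦ L(1+z,χ)` is entire (`χ ≠ 1`). [folklore] -/
theorem differentiable_LFunction_one_add (hχ1 : χ ≠ 1) :
    Differentiable ℂ (fun z : ℂ => χ.LFunction (1 + z)) :=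
  (DirichletCharacter.differentiable_LFunction hχ1).comp ((differentiable_const _).add differentiable_id)

/-- `h` is differentiable on `re z > −1/2` (`χ ≠ 1`). [folklore] -/
theorem differentiableOn_h1 (hχ1 : χ ≠ 1) (hX : 0 < X) :
    DifferentiableOn ℂ (h1 χ X) {z : ℂ | -(1 / 2) < z.re} := fun z hz =>
  (differentiableOn_u1 hX z hz).mul ((differentiable_LFunction_one_add χ hχ1) z).differentiableWithinAt

/-- `F` is differentiable on `re z > −1/2` away from `z = 0`. [folklore] -/
theorem differentiableOn_F1 (hχ1 : χ ≠ 1) (hX : 0 < X) :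
    DifferentiableOn ℂ (F1 χ X) ({z : ℂ | -(1 / 2) < z.re} \ {0}) := by
  intro z hz
  have hz0 : z ≠ 0 := hz.2
  refine DifferentiableAt.differentiableWithinAt ?_
  refine DifferentiableAt.mul (DifferentiableAt.mul (DifferentiableAt.mul ?_ ?_) ?_)
    ((differentiable_LFunction_one_add χ hχ1) z)
  · have hne : (1 : ℂ) + z ≠ 1 := by intro h; exact hz0 (by linear_combination h)
    exact (differentiableAt_riemannZeta hne).comp z (differentiableAt_id.const_add _)
  · refine Complex.differentiableAt_Gamma _ fun m hm => ?_
    rcases Nat.eq_zero_or_pos m with rfl | hm0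
    · exact hz0 (by simpa using hm)
    · have := congrArg Complex.re hm
      have hz1 : -(1 / 2) < z.re := hz.1
      simp at this
      have h1 : (1 : ℝ) ≤ m := by exact_mod_cast hm0
      linarith
  · exact differentiableAt_id.const_cpow (Or.inl (ofReal_ne_zero.2 hX.ne'))

/-! ### §2. The line `re z = 2`: Mellin -/

omit [NeZero D] in
/-- `|ν(n)| ≤ d(n) ≤ n`. [folklore] -/
theorem norm_divisorSumChar_le_self (n : ℕ) : ‖divisorSumChar χ n‖ ≤ 1 * n := by
  rw [one_mul]
  exact (norm_divisorSumChar_le χ n).trans (by exact_mod_cast Nat.card_divisors_le_self n)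

/-- **Mellin on `re z = 2`**: integrability and `∫ F(2+iy) dy = 2π W_ν(X)`,
`W_ν(X) = ∑ ν(n) e^{-n/X}/n`. [cite: Zhang2022LandauSiegel, §5, proof of Lemma 5.7] -/
theorem integral_F1_line_two (hX : 0 < X) :
    Integrable (fun y : ℝ => F1 χ X (2 + y * I)) ∧
    ∫ y : ℝ, F1 χ X (2 + y * I) = 2 * π * W (fun n => divisorSumChar χ n) X := by
  have hC := norm_divisorSumChar_le_self χ
  have I₁ := integrable_Gamma_cpow_LSeries hC hX
  have hfun : (fun y : ℝ => F1 χ X (2 + y * I)) = fun y : ℝ =>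
      Complex.Gamma (2 + y * I) * (X : ℂ) ^ (2 + y * I : ℂ) *
        L (fun n => divisorSumChar χ n) (1 + (2 + y * I)) :=
    funext fun y => F1_eq_of_pos χ (by simp)
  rw [hfun]
  exact ⟨I₁, integral_Gamma_cpow_LSeries_eq hC hX⟩

/-! ### §3. Arithmetic: `ν ≥ 0`, `ν = 1` on the divisors of `D`, and the lower bound -/

section Arithmetic

omit [NeZero D]

/-- **`ν(n) ≥ 0`** for a quadratic `χ`: `ν` is multiplicative with
`ν(pᵏ) = ∑_{i≤k} χ(p)ⁱ ∈ {k+1, 0 or 1, 1}` according as `χ(p) = 1, −1, 0`. [folklore] -/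
theorem divisorSumChar_re_nonneg (hχ : χ ^ 2 = 1) (n : ℕ) : 0 ≤ (divisorSumChar χ n).re := by
  rw [← nuOf_reChar_eq]
  rcases eq_or_ne n 0 with rfl | hn
  · simp [nuOf]
  have hmult : (nuOf (reChar χ)).IsMultiplicative :=
    isMultiplicative_zeta.natCast.mul (isMultiplicative_reChar χ hχ)
  rw [hmult.multiplicative_factorization _ hn, Finsupp.prod]
  refine Finset.prod_nonneg fun p hp => ?_
  rw [Nat.support_factorization] at hp
  have hp' : p.Prime := Nat.prime_of_mem_primeFactors hp
  rw [nuOf_apply_prime_pow _ (reChar_mul_all χ hχ) (reChar_one χ) hp']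
  rcases reChar_trichotomy χ hχ p with h0 | h1 | hm1
  · rw [h0]
    exact Finset.sum_nonneg fun i _ => pow_nonneg le_rfl i
  · rw [h1]
    exact Finset.sum_nonneg fun i _ => by rw [one_pow]; exact zero_le_one
  · rw [hm1, neg_one_geom_sum]
    split_ifs <;> norm_num

/-- **`ν(n) = 1` for `n ∣ D`**, `n ≥ 1`: every divisor `d > 1` of `n` divides the modulus, so
`χ(d) = 0`. [cite: Zhang2022LandauSiegel, §5, proof of Lemma 5.7 ("since ν(n) = 1 if n ∣ D")] -/
theorem divisorSumChar_of_dvd {n : ℕ} (hn : n ≠ 0) (hnD : n ∣ D) : divisorSumChar χ n = 1 := by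
  rw [divisorSumChar_apply]
  rw [Finset.sum_eq_single_of_mem 1 (Nat.one_mem_divisors.mpr hn)]
  · simp
  · intro d hd hd1
    have hdn : d ∣ n := Nat.dvd_of_mem_divisors hd
    have hdD : d ∣ D := hdn.trans hnD
    have hnot : ¬ IsUnit ((d : ℕ) : ZMod D) := by
      rw [ZMod.isUnit_iff_coprime]
      intro hcop
      have : Nat.gcd d D = d := Nat.gcd_eq_left hdD
      rw [Nat.Coprime] at hcop
      omega
    exact MulChar.map_nonunit χ hnot

/-- `W_ν(Y)` is the real series `∑ Re ν(n) e^{-n/Y}/n` (for `χ² = 1`). [folklore] -/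
theorem W_nu_eq (hχ : χ ^ 2 = 1) (Y : ℝ) :
    W (fun n => divisorSumChar χ n) Y =
      ((∑' n : ℕ, (divisorSumChar χ n).re * Real.exp (-(n / Y)) / n : ℝ) : ℂ) := by
  have : (fun n => divisorSumChar χ n) = fun n => (((divisorSumChar χ n).re : ℝ) : ℂ) := by
    funext n
    apply Complex.ext <;> simp [divisorSumChar_im_eq_zero χ hχ n]
  rw [this, W_ofReal]

/-- Summability of `∑ Re ν(n) e^{-n/Y}/n` for `Y > 0`. [folklore] -/
theorem summable_nu_re {Y : ℝ} (hY : 0 < Y) :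
    Summable fun n : ℕ => (divisorSumChar χ n).re * Real.exp (-(n / Y)) / n := by
  refine summable_mul_exp_div (C := 1) (fun n => ?_) hY
  calc |(divisorSumChar χ n).re| ≤ ‖divisorSumChar χ n‖ := Complex.abs_re_le_norm _
    _ ≤ 1 * n := norm_divisorSumChar_le_self χ n

/-- **The lower bound** ("`≫ ∑_{n∣D} 1/n`"): for `χ² = 1` and `Y ≥ D`,
`Re W_ν(Y) ≥ e^{-1} ∑_{n∣D} 1/n`. [cite: Zhang2022LandauSiegel, §5, proof of Lemma 5.7] -/
theorem re_W_nu_ge (hχ : χ ^ 2 = 1) {Y : ℝ} (hY : 0 < Y) (hDY : (D : ℝ) ≤ Y) :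
    Real.exp (-1) * ∑ n ∈ D.divisors, (1 : ℝ) / n ≤ (W (fun n => divisorSumChar χ n) Y).re := by
  rw [W_nu_eq χ hχ, ofReal_re]
  have hs := summable_nu_re χ hY
  have h0 : ∀ n, 0 ≤ (divisorSumChar χ n).re * Real.exp (-(n / Y)) / n := fun n =>
    div_nonneg (mul_nonneg (divisorSumChar_re_nonneg χ hχ n) (Real.exp_pos _).le) (Nat.cast_nonneg n)
  refine le_trans ?_ (hs.sum_le_tsum D.divisors fun n _ => h0 n)
  rw [Finset.mul_sum]
  refine Finset.sum_le_sum fun n hn => ?_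
  have hn0 : n ≠ 0 := (Nat.pos_of_mem_divisors hn).ne'
  have hnD : n ∣ D := Nat.dvd_of_mem_divisors hn
  have hnle : (n : ℝ) ≤ D := by exact_mod_cast Nat.divisor_le hn
  rw [divisorSumChar_of_dvd χ hn0 hnD, one_re, one_mul]
  have hexp : Real.exp (-1) ≤ Real.exp (-(n / Y)) := by
    rw [Real.exp_le_exp, neg_le_neg_iff, div_le_one hY]; linarith
  have hnpos : (0 : ℝ) < n := by exact_mod_cast Nat.pos_of_mem_divisors hn
  rw [mul_one_div]
  exact div_le_div_of_nonneg_right hexp hnpos.le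

/-- `∑_{n∣D} 1/n ≥ ∏_{p∣D}(1 + 1/p)` (expand the product over the squarefree divisors). [folklore] -/
theorem prod_one_add_inv_le_sum_divisors (hD : D ≠ 0) :
    ∏ p ∈ D.primeFactors, (1 + (1 : ℝ) / p) ≤ ∑ n ∈ D.divisors, (1 : ℝ) / n := by
  rw [Finset.prod_one_add]
  -- `t ↦ ∏_{p ∈ t} p` maps the subsets of the prime factors injectively into the divisors
  set e : Finset ℕ → ℕ := fun t => ∏ p ∈ t, p with he
  have hprime : ∀ t ∈ D.primeFactors.powerset, ∀ p ∈ t, p.Prime := fun t ht p hp =>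
    Nat.prime_of_mem_primeFactors (Finset.mem_powerset.mp ht hp)
  have hinj : Set.InjOn e ↑(D.primeFactors.powerset) := by
    intro t₁ ht₁ t₂ ht₂ h
    have h1 := Nat.primeFactors_prod (hprime t₁ ht₁)
    have h2 := Nat.primeFactors_prod (hprime t₂ ht₂)
    rw [← h1, ← h2]
    exact congrArg Nat.primeFactors h
  have himg : (D.primeFactors.powerset).image e ⊆ D.divisors := by
    intro d hd
    obtain ⟨t, ht, rfl⟩ := Finset.mem_image.mp hd
    rw [Nat.mem_divisors]
    refine ⟨?_, hD⟩
    exact Finset.prod_primes_dvd D (fun p hp => (hprime t ht p hp).prime)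
      (fun p hp => Nat.dvd_of_mem_primeFactors (Finset.mem_powerset.mp ht hp))
  have hterm : ∀ t ∈ D.primeFactors.powerset, ∏ i ∈ t, (1 : ℝ) / i = 1 / (e t : ℝ) := by
    intro t _
    rw [he]; push_cast
    rw [Finset.prod_div_distrib, Finset.prod_const_one]
  calc ∑ t ∈ D.primeFactors.powerset, ∏ i ∈ t, (1 : ℝ) / i
      = ∑ t ∈ D.primeFactors.powerset, 1 / (e t : ℝ) := Finset.sum_congr rfl hterm
    _ = ∑ d ∈ (D.primeFactors.powerset).image e, (1 : ℝ) / d :=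
        (Finset.sum_image (f := fun d : ℕ => (1 : ℝ) / d) hinj).symm
    _ ≤ ∑ n ∈ D.divisors, (1 : ℝ) / n :=
        Finset.sum_le_sum_of_subset_of_nonneg himg fun n _ _ => by positivity

/-- `1 ≤ ∑_{n∣D} 1/n` (the divisor `1`). [folklore] -/
theorem one_le_sum_divisors (hD : D ≠ 0) : (1 : ℝ) ≤ ∑ n ∈ D.divisors, (1 : ℝ) / n := by
  have h := Finset.single_le_sum (f := fun n : ℕ => (1 : ℝ) / n) (fun n _ => by positivity)
    (Nat.one_mem_divisors.mpr hD)
  simpa using h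

/-- The telescoping product `∏_{2 ≤ n ≤ N}(1 − 1/n²) = (N+1)/(2N)` (`N ≥ 1`). [folklore] -/
theorem prod_Icc_one_sub_inv_sq (N : ℕ) (hN : 1 ≤ N) :
    ∏ n ∈ Finset.Icc 2 N, (1 - 1 / (n : ℝ) ^ 2) = ((N : ℝ) + 1) / (2 * N) := by
  induction N with
  | zero => exact absurd hN (by norm_num)
  | succ k ih =>
    rcases Nat.eq_zero_or_pos k with rfl | hk
    · norm_num
    · rw [Finset.prod_Icc_succ_top (by omega), ih hk]
      have hk0 : (k : ℝ) ≠ 0 := by exact_mod_cast hk.ne'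
      have hk1 : (k : ℝ) + 1 ≠ 0 := by positivity
      push_cast
      field_simp
      ring

/-- `∏_{p∣D}(1 − 1/p²) ≥ 1/2` (the primes dividing `D` are distinct integers in `[2, D]`, and
`∏_{2≤n≤D}(1 − 1/n²) = (D+1)/(2D)`). [folklore] -/
theorem half_le_prod_one_sub_inv_sq (hD : D ≠ 0) :
    (1 : ℝ) / 2 ≤ ∏ p ∈ D.primeFactors, (1 - 1 / (p : ℝ) ^ 2) := by
  have hsub : D.primeFactors ⊆ Finset.Icc 2 D := by
    intro p hp
    rw [Finset.mem_Icc]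
    exact ⟨(Nat.prime_of_mem_primeFactors hp).two_le, Nat.le_of_mem_primeFactors hp⟩
  have hle1 : ∀ n ∈ Finset.Icc 2 D, (1 - 1 / (n : ℝ) ^ 2) ≤ 1 := fun n _ => by
    have : 0 ≤ 1 / (n : ℝ) ^ 2 := by positivity
    linarith
  have hge0 : ∀ n ∈ Finset.Icc 2 D, 0 ≤ (1 - 1 / (n : ℝ) ^ 2) := fun n hn => by
    have h2 : (2 : ℝ) ≤ n := by exact_mod_cast (Finset.mem_Icc.mp hn).1
    have : 1 / (n : ℝ) ^ 2 ≤ 1 := by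
      rw [div_le_one (by positivity)]; nlinarith
    linarith
  have hD1 : 1 ≤ D := Nat.one_le_iff_ne_zero.mpr hD
  have hfull := prod_Icc_one_sub_inv_sq D hD1
  rw [← Finset.prod_sdiff hsub] at hfull
  have hrest : ∏ n ∈ Finset.Icc 2 D \ D.primeFactors, (1 - 1 / (n : ℝ) ^ 2) ≤ 1 :=
    Finset.prod_le_one (fun n hn => hge0 n (Finset.mem_sdiff.mp hn).1)
      (fun n hn => hle1 n (Finset.mem_sdiff.mp hn).1)
  have hP0 : 0 ≤ ∏ p ∈ D.primeFactors, (1 - 1 / (p : ℝ) ^ 2) :=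
    Finset.prod_nonneg fun p hp => hge0 p (hsub hp)
  have hDpos : (0 : ℝ) < D := by exact_mod_cast hD1
  have hhalf : (1 : ℝ) / 2 ≤ ((D : ℝ) + 1) / (2 * D) := by
    rw [div_le_div_iff₀ (by norm_num) (by positivity)]; linarith
  calc (1 : ℝ) / 2 ≤ ((D : ℝ) + 1) / (2 * D) := hhalf
    _ = (∏ n ∈ Finset.Icc 2 D \ D.primeFactors, (1 - 1 / (n : ℝ) ^ 2)) *
          ∏ p ∈ D.primeFactors, (1 - 1 / (p : ℝ) ^ 2) := hfull.symm
    _ ≤ 1 * ∏ p ∈ D.primeFactors, (1 - 1 / (p : ℝ) ^ 2) := mul_le_mul_of_nonneg_right hrest hP0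
    _ = _ := one_mul _

/-- `D/φ(D) = ∏_{p∣D} p/(p−1)` (Mathlib's `Nat.totient_mul_prod_primeFactors`). [folklore] -/
theorem self_div_totient_eq (hD : D ≠ 0) :
    (D : ℝ) / (Nat.totient D) = ∏ p ∈ D.primeFactors, ((p : ℝ) / (p - 1)) := by
  have h := Nat.totient_mul_prod_primeFactors D
  have hφ : (0 : ℝ) < Nat.totient D := by exact_mod_cast Nat.totient_pos.mpr (Nat.pos_of_ne_zero hD)
  have hP : (0 : ℝ) < ∏ p ∈ D.primeFactors, ((p : ℝ) - 1) :=
    Finset.prod_pos fun p hp => by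
      have := (Nat.prime_of_mem_primeFactors hp).two_le
      have : (2 : ℝ) ≤ p := by exact_mod_cast this
      linarith
  have hcast : ((∏ p ∈ D.primeFactors, (p - 1) : ℕ) : ℝ) = ∏ p ∈ D.primeFactors, ((p : ℝ) - 1) := by
    rw [Nat.cast_prod]
    refine Finset.prod_congr rfl fun p hp => ?_
    rw [Nat.cast_sub (Nat.prime_of_mem_primeFactors hp).one_le]; simp
  have h' : (Nat.totient D : ℝ) * ∏ p ∈ D.primeFactors, (p : ℝ) = D * ∏ p ∈ D.primeFactors, ((p : ℝ) - 1) := by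
    have := congrArg (fun m : ℕ => (m : ℝ)) h
    simp only [Nat.cast_mul, Nat.cast_prod] at this
    rw [this, ← hcast]; push_cast; rfl
  rw [Finset.prod_div_distrib, div_eq_div_iff hφ.ne' hP.ne']
  linarith [h']

/-- **`∑_{n∣D} 1/n ≥ (1/2) D/φ(D)`** (the source's "`∑_{n∣D} 1/n ≫ D/φ(D)`", with the constant
`∏_{p∣D}(1−p^{-2}) ≥ 1/2`). [cite: Zhang2022LandauSiegel, §5, proof of Lemma 5.7] -/
theorem half_self_div_totient_le_sum_divisors (hD : D ≠ 0) :
    (1 : ℝ) / 2 * ((D : ℝ) / Nat.totient D) ≤ ∑ n ∈ D.divisors, (1 : ℝ) / n := by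
  refine le_trans ?_ (prod_one_add_inv_le_sum_divisors hD)
  rw [self_div_totient_eq hD]
  have hfac : ∀ p ∈ D.primeFactors,
      (1 - 1 / (p : ℝ) ^ 2) * ((p : ℝ) / (p - 1)) = 1 + 1 / (p : ℝ) := by
    intro p hp
    have h2 : (2 : ℝ) ≤ p := by exact_mod_cast (Nat.prime_of_mem_primeFactors hp).two_le
    have hp0 : (p : ℝ) ≠ 0 := by positivity
    have hp1 : (p : ℝ) - 1 ≠ 0 := by intro h; linarith
    field_simp
    ring
  have heq : ∏ p ∈ D.primeFactors, (1 + 1 / (p : ℝ)) =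
      (∏ p ∈ D.primeFactors, (1 - 1 / (p : ℝ) ^ 2)) * ∏ p ∈ D.primeFactors, ((p : ℝ) / (p - 1)) := by
    rw [← Finset.prod_mul_distrib]
    exact Finset.prod_congr rfl fun p hp => (hfac p hp).symm
  rw [heq]
  have hQ0 : 0 ≤ ∏ p ∈ D.primeFactors, ((p : ℝ) / (p - 1)) :=
    Finset.prod_nonneg fun p hp => by
      have h2 : (2 : ℝ) ≤ p := by exact_mod_cast (Nat.prime_of_mem_primeFactors hp).two_le
      exact div_nonneg (by linarith) (by linarith)
  exact mul_le_mul_of_nonneg_right (half_le_prod_one_sub_inv_sq hD) hQ0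

end Arithmetic

/-! ### §4. Bounds in the strip `−1/4 ≤ re z ≤ 2`; the lines and the horizontal decay -/

section Strip

variable (X) in
/-- The constant of the strip bound for `F`. [folklore] -/
def KF1 (D : ℕ) : ℝ := 4 * 5 ^ 4 * (4 * CΓ) * (X ^ (-(1 / 4) : ℝ) + X ^ (2 : ℝ)) * (3 * (D : ℝ) * Zconst)

omit [NeZero D] in
/-- `K_F ≥ 0`. [folklore] -/
theorem KF1_nonneg (hX : 0 < X) (D : ℕ) : 0 ≤ KF1 X D := by
  unfold KF1
  have := CΓ_pos
  have := Zconst_nonneg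
  positivity

/-- **`F` in the strip**: for `χ ≠ 1`, `−1/4 ≤ re z ≤ 2`, `‖z‖ ≥ 1/4`,
`‖F(z)‖ ≤ K_F (1+|im z|)⁸ e^{-π|im z|/2}`. [folklore] -/
theorem norm_F1_le (hχ1 : χ ≠ 1) (hX : 0 < X) {z : ℂ}
    (h1 : -(1 / 4) ≤ z.re) (h2 : z.re ≤ 2) (hz : 1 / 4 ≤ ‖z‖) :
    ‖F1 χ X z‖ ≤ KF1 X D * ((1 + |z.im|) ^ 8 * Real.exp (-(π * |z.im| / 2))) := by
  have hy0 := abs_nonneg z.im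
  have hz0 : z ≠ 0 := by
    intro h; rw [h, norm_zero] at hz; norm_num at hz
  have hzpos : 0 < ‖z‖ := by linarith
  have hzn : ‖z‖ ≤ 2 + |z.im| := by
    have := Complex.norm_le_abs_re_add_abs_im z
    have : |z.re| ≤ 2 := abs_le.2 ⟨by linarith, h2⟩
    linarith
  have h1z : ‖(1 : ℂ) + z‖ ≤ 3 * (1 + |z.im|) := by
    have := norm_add_le (1 : ℂ) z
    rw [norm_one] at this
    linarith
  have hz1 : (1 : ℂ) + z ≠ 1 := by intro h; exact hz0 (by linear_combination h)
  have hζ₁ : ‖riemannZeta₁ (1 + z)‖ ≤ 5 ^ 4 * (1 + |z.im|) ^ 4 := by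
    have h := BurnolVectors.norm_riemannZeta₁_le (s := 1 + z) (by simp; linarith)
    refine h.trans ?_
    have : ‖(1 : ℂ) + z‖ + 2 ≤ 5 * (1 + |z.im|) := by linarith
    calc (‖(1 : ℂ) + z‖ + 2) ^ 4 ≤ (5 * (1 + |z.im|)) ^ 4 := by gcongr
      _ = 5 ^ 4 * (1 + |z.im|) ^ 4 := by ring
  have hζ : ‖riemannZeta (1 + z)‖ ≤ 4 * 5 ^ 4 * (1 + |z.im|) ^ 4 := by
    have e : riemannZeta (1 + z) = riemannZeta₁ (1 + z) / z := by
      rw [LFunctions.riemannZeta₁_eq_mul hz1, add_sub_cancel_left]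
      field_simp
    rw [e, norm_div, div_le_iff₀ hzpos]
    calc ‖riemannZeta₁ (1 + z)‖ ≤ 5 ^ 4 * (1 + |z.im|) ^ 4 := hζ₁
      _ = 4 * 5 ^ 4 * (1 + |z.im|) ^ 4 * (1 / 4) := by ring
      _ ≤ 4 * 5 ^ 4 * (1 + |z.im|) ^ 4 * ‖z‖ := by gcongr
  have hΓ1 : ‖Complex.Gamma (z + 1)‖ ≤ CΓ * (1 + |z.im|) ^ 3 * Real.exp (-(π * |z.im| / 2)) := by
    have := norm_Gamma_strip_le (x := z.re + 1) (by linarith) (by linarith) z.im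
    have e : ((z.re + 1 : ℝ) : ℂ) + z.im * I = z + 1 := by
      rw [show ((z.re + 1 : ℝ) : ℂ) = (z.re : ℂ) + 1 by push_cast; ring]
      conv_rhs => rw [← Complex.re_add_im z]
      ring
    rwa [e] at this
  have hC := CΓ_pos
  have hE := Real.exp_pos (-(π * |z.im| / 2))
  have hΓ : ‖Complex.Gamma z‖ ≤ 4 * CΓ * (1 + |z.im|) ^ 3 * Real.exp (-(π * |z.im| / 2)) := by
    have e : Complex.Gamma z = Complex.Gamma (z + 1) / z := by
      rw [Complex.Gamma_add_one _ hz0]; field_simp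
    rw [e, norm_div, div_le_iff₀ hzpos]
    calc ‖Complex.Gamma (z + 1)‖ ≤ CΓ * (1 + |z.im|) ^ 3 * Real.exp (-(π * |z.im| / 2)) := hΓ1
      _ = 4 * CΓ * (1 + |z.im|) ^ 3 * Real.exp (-(π * |z.im| / 2)) * (1 / 4) := by ring
      _ ≤ 4 * CΓ * (1 + |z.im|) ^ 3 * Real.exp (-(π * |z.im| / 2)) * ‖z‖ := by gcongr
  have hXz : ‖(X : ℂ) ^ z‖ ≤ X ^ (-(1 / 4) : ℝ) + X ^ (2 : ℝ) := by
    rw [Complex.norm_cpow_eq_rpow_re_of_pos hX]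
    exact rpow_le_rpow_add hX h1 h2
  have hZ0 := Zconst_nonneg
  have hL : ‖χ.LFunction (1 + z)‖ ≤ 3 * (D : ℝ) * Zconst * (1 + |z.im|) := by
    refine (norm_LFunction_one_add_le χ hχ1 h1).trans ?_
    calc (D : ℝ) * ‖(1 : ℂ) + z‖ * Zconst ≤ (D : ℝ) * (3 * (1 + |z.im|)) * Zconst := by gcongr
      _ = _ := by ring
  have hXs : 0 ≤ X ^ (-(1 / 4) : ℝ) + X ^ (2 : ℝ) := by positivity
  have s1 : ‖riemannZeta (1 + z)‖ * ‖Complex.Gamma z‖ ≤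
      (4 * 5 ^ 4 * (1 + |z.im|) ^ 4) * (4 * CΓ * (1 + |z.im|) ^ 3 * Real.exp (-(π * |z.im| / 2))) :=
    mul_le_mul hζ hΓ (norm_nonneg _) (by positivity)
  have s2 : ‖riemannZeta (1 + z)‖ * ‖Complex.Gamma z‖ * ‖(X : ℂ) ^ z‖ ≤
      (4 * 5 ^ 4 * (1 + |z.im|) ^ 4) * (4 * CΓ * (1 + |z.im|) ^ 3 * Real.exp (-(π * |z.im| / 2))) *
        (X ^ (-(1 / 4) : ℝ) + X ^ (2 : ℝ)) :=
    mul_le_mul s1 hXz (norm_nonneg _) (by positivity)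
  have s3 : ‖riemannZeta (1 + z)‖ * ‖Complex.Gamma z‖ * ‖(X : ℂ) ^ z‖ * ‖χ.LFunction (1 + z)‖ ≤
      (4 * 5 ^ 4 * (1 + |z.im|) ^ 4) * (4 * CΓ * (1 + |z.im|) ^ 3 * Real.exp (-(π * |z.im| / 2))) *
        (X ^ (-(1 / 4) : ℝ) + X ^ (2 : ℝ)) * (3 * (D : ℝ) * Zconst * (1 + |z.im|)) :=
    mul_le_mul s2 hL (norm_nonneg _) (by positivity)
  rw [F1, norm_mul, norm_mul, norm_mul]
  refine s3.trans (le_of_eq ?_)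
  rw [KF1]; ring

/-- `y ↦ F(c+iy)` is continuous for `c > −1/2`, `c ≠ 0`. [folklore] -/
theorem continuous_F1_line (hχ1 : χ ≠ 1) (hX : 0 < X) {c : ℝ}
    (hc : -(1 / 2) < c) (hc0 : c ≠ 0) :
    Continuous fun y : ℝ => F1 χ X (c + y * I) := by
  have hd := differentiableOn_F1 χ hχ1 hX
  have hline : Continuous fun y : ℝ => (c : ℂ) + y * I := by fun_prop
  refine hd.continuousOn.comp_continuous hline fun y => ⟨?_, ?_⟩
  · simp only [mem_setOf_eq, add_re, ofReal_re, mul_re, I_re, mul_zero, ofReal_im, I_im, mul_one,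
      sub_self, add_zero]; exact hc
  · intro h
    have := congrArg Complex.re h
    simp at this
    exact hc0 this

/-- Integrability of `F` on the lines `re z = −1/4` and `re z = 2`. [folklore] -/
theorem integrable_F1_line (hχ1 : χ ≠ 1) (hX : 0 < X) {c : ℝ}
    (hc : c = -(1 / 4) ∨ c = 2) :
    Integrable fun y : ℝ => F1 χ X (c + y * I) := by
  have hc1 : -(1 / 4) ≤ c := by rcases hc with h | h <;> norm_num [h]
  have hc2 : c ≤ 2 := by rcases hc with h | h <;> norm_num [h]
  have hca : 1 / 4 ≤ |c| := by
    rcases hc with h | h <;> (rw [h]; norm_num [abs_of_neg, abs_of_pos])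
  have hc0 : c ≠ 0 := by intro h; rw [h] at hca; norm_num at hca
  have hcont := continuous_F1_line χ hχ1 hX (c := c) (by linarith) hc0
  refine (((integrable_pow_mul_exp 8).const_mul (KF1 X D)).mono' hcont.aestronglyMeasurable
    (Eventually.of_forall fun y => ?_))
  have hw : 1 / 4 ≤ ‖((c : ℂ) + y * I)‖ := by
    have hre : (((c : ℂ) + y * I)).re = c := by simp
    have := abs_re_le_norm (((c : ℂ) + y * I))
    rw [hre] at this
    exact hca.trans this
  have him : (((c : ℂ) + y * I)).im = y := by simp
  have hb := norm_F1_le χ hχ1 hX (z := ((c : ℂ) + y * I)) (by simpa using hc1)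
    (by simpa using hc2) hw
  rw [him] at hb
  exact hb

/-- Horizontal decay of `F` in the strip. [folklore] -/
theorem F1_horizontal_decay (hχ1 : χ ≠ 1) (hX : 0 < X) (ε : ℝ) (hε : 0 < ε) :
    ∃ T₀ : ℝ, ∀ T : ℝ, T₀ ≤ |T| → ∀ u ∈ Icc (-(1 / 4) : ℝ) 2, ‖F1 χ X (u + T * I)‖ ≤ ε := by
  have hK0 := KF1_nonneg (X := X) hX D
  obtain ⟨T₁, hT₁⟩ := exists_pow_mul_exp_le 8 hK0 hε
  refine ⟨max T₁ 1, fun T hT u hu => ?_⟩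
  have hTT : T₁ ≤ |T| := le_trans (le_max_left _ _) hT
  have hT1 : 1 ≤ |T| := le_trans (le_max_right _ _) hT
  set w : ℂ := (u : ℂ) + T * I with hw
  have hwim : w.im = T := by simp [hw]
  have hwre : w.re = u := by simp [hw]
  have hwn : 1 / 4 ≤ ‖w‖ := by
    have := abs_im_le_norm w; rw [hwim] at this; linarith
  have hb := norm_F1_le χ hχ1 hX (z := w) (by rw [hwre]; exact hu.1) (by rw [hwre]; exact hu.2) hwn
  rw [hwim] at hb
  exact hb.trans (hT₁ T hTT)

end Strip

/-! ### §5. The line `re z = −1/4` with the `D`-dependence explicit -/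

section LineBound

/-- The absolute constant of the line bound. [folklore] -/
def Kline57 : ℝ := 4 * 5 ^ 4 * (4 * CΓ) * (3 * Real.exp (3 / 2))

omit [NeZero D] in
/-- `Kline57 > 0`. [folklore] -/
theorem Kline57_pos : 0 < Kline57 := by unfold Kline57; have := CΓ_pos; positivity

omit [NeZero D] in
/-- `(√D (1+𝓛))^{1/4} ≤ D^{1/8} (1+𝓛)`. [folklore] -/
theorem sqrt_mul_rpow_quarter_le (hD : 0 < (D : ℝ)) (hL : 0 ≤ Real.log D) :
    (Real.sqrt D * (1 + Real.log D)) ^ (1 / 4 : ℝ) ≤ (D : ℝ) ^ (1 / 8 : ℝ) * (1 + Real.log D) := by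
  rw [Real.mul_rpow (Real.sqrt_nonneg _) (by linarith), Real.sqrt_eq_rpow, ← Real.rpow_mul hD.le]
  norm_num
  refine mul_le_mul_of_nonneg_left ?_ (by positivity)
  calc (1 + Real.log D) ^ (1 / 4 : ℝ) ≤ (1 + Real.log D) ^ (1 : ℝ) :=
        Real.rpow_le_rpow_of_exponent_le (by linarith) (by norm_num)
    _ = 1 + Real.log D := Real.rpow_one _

/-- **`F` on the line `re z = −1/4`** (`χ` primitive mod `D ≥ 8`):
`‖F(−1/4+iy)‖ ≤ K D^{1/8} (1+𝓛)² X^{-1/4} (1+|y|)⁸ e^{-π|y|/2}` (`L(3/4+it,χ)` by the tree's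
Pólya–Vinogradov-strength bound `DirichletAbel.norm_LFunction_le_polyaVinogradov_of_half_le`).
[cite: Zhang2022LandauSiegel, §5, proof of Lemma 5.7 ("moving the line of integration to the left")] -/
theorem norm_F1_line_le (hprim : χ.IsPrimitive) (hD8 : 8 ≤ D) (hX : 0 < X) (y : ℝ) :
    ‖F1 χ X (((-(1 / 4) : ℝ) : ℂ) + y * I)‖ ≤
      Kline57 * (D : ℝ) ^ (1 / 8 : ℝ) * (1 + Real.log D) ^ 2 * X ^ (-(1 / 4) : ℝ) *
        ((1 + |y|) ^ 8 * Real.exp (-(π * |y| / 2))) := by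
  have hD0 : D ≠ 0 := by omega
  have hDpos : (0 : ℝ) < D := by exact_mod_cast Nat.pos_of_ne_zero hD0
  have hlog0 : 0 ≤ Real.log D := Real.log_nonneg (by exact_mod_cast Nat.one_le_iff_ne_zero.2 hD0)
  generalize hzdef : (((-(1 / 4) : ℝ) : ℂ) + y * I) = z
  have hzre : z.re = -(1 / 4) := by rw [← hzdef]; simp
  have hzim : z.im = y := by rw [← hzdef]; simp
  have hy0 := abs_nonneg y
  have hz : 1 / 4 ≤ ‖z‖ := by
    have := Complex.abs_re_le_norm z
    rw [hzre, abs_neg, abs_of_pos (by norm_num : (0:ℝ) < 1 / 4)] at this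
    exact this
  have hzpos : 0 < ‖z‖ := by linarith
  have hz0 : z ≠ 0 := by
    intro h; rw [h, norm_zero] at hz; norm_num at hz
  have hzn : ‖z‖ ≤ 1 / 4 + |y| := by
    have := Complex.norm_le_abs_re_add_abs_im z
    rw [hzre, hzim, abs_neg, abs_of_pos (by norm_num : (0:ℝ) < 1 / 4)] at this
    exact this
  have h1z : ‖(1 : ℂ) + z‖ ≤ 3 * (1 + |y|) := by
    have := norm_add_le (1 : ℂ) z
    rw [norm_one] at this
    linarith
  have hz1 : (1 : ℂ) + z ≠ 1 := by intro h; exact hz0 (by linear_combination h)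
  have hζ₁ : ‖riemannZeta₁ (1 + z)‖ ≤ 5 ^ 4 * (1 + |y|) ^ 4 := by
    have h := BurnolVectors.norm_riemannZeta₁_le (s := 1 + z) (by rw [add_re, one_re, hzre]; norm_num)
    refine h.trans ?_
    have : ‖(1 : ℂ) + z‖ + 2 ≤ 5 * (1 + |y|) := by linarith
    calc (‖(1 : ℂ) + z‖ + 2) ^ 4 ≤ (5 * (1 + |y|)) ^ 4 := by gcongr
      _ = 5 ^ 4 * (1 + |y|) ^ 4 := by ring
  have hζ : ‖riemannZeta (1 + z)‖ ≤ 4 * 5 ^ 4 * (1 + |y|) ^ 4 := by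
    have e : riemannZeta (1 + z) = riemannZeta₁ (1 + z) / z := by
      rw [LFunctions.riemannZeta₁_eq_mul hz1, add_sub_cancel_left]
      field_simp
    rw [e, norm_div, div_le_iff₀ hzpos]
    calc ‖riemannZeta₁ (1 + z)‖ ≤ 5 ^ 4 * (1 + |y|) ^ 4 := hζ₁
      _ = 4 * 5 ^ 4 * (1 + |y|) ^ 4 * (1 / 4) := by ring
      _ ≤ 4 * 5 ^ 4 * (1 + |y|) ^ 4 * ‖z‖ := by gcongr
  have hΓ1 : ‖Complex.Gamma (z + 1)‖ ≤ CΓ * (1 + |y|) ^ 3 * Real.exp (-(π * |y| / 2)) := by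
    have := norm_Gamma_strip_le (x := z.re + 1) (by rw [hzre]; norm_num) (by rw [hzre]; norm_num) z.im
    have e : ((z.re + 1 : ℝ) : ℂ) + z.im * I = z + 1 := by
      rw [show ((z.re + 1 : ℝ) : ℂ) = (z.re : ℂ) + 1 by push_cast; ring]
      conv_rhs => rw [← Complex.re_add_im z]
      ring
    rwa [e, hzim] at this
  have hC := CΓ_pos
  have hE := Real.exp_pos (-(π * |y| / 2))
  have hΓ : ‖Complex.Gamma z‖ ≤ 4 * CΓ * (1 + |y|) ^ 3 * Real.exp (-(π * |y| / 2)) := by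
    have e : Complex.Gamma z = Complex.Gamma (z + 1) / z := by
      rw [Complex.Gamma_add_one _ hz0]; field_simp
    rw [e, norm_div, div_le_iff₀ hzpos]
    calc ‖Complex.Gamma (z + 1)‖ ≤ CΓ * (1 + |y|) ^ 3 * Real.exp (-(π * |y| / 2)) := hΓ1
      _ = 4 * CΓ * (1 + |y|) ^ 3 * Real.exp (-(π * |y| / 2)) * (1 / 4) := by ring
      _ ≤ 4 * CΓ * (1 + |y|) ^ 3 * Real.exp (-(π * |y| / 2)) * ‖z‖ := by gcongr
  have hXz : ‖(X : ℂ) ^ z‖ = X ^ (-(1 / 4) : ℝ) := by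
    rw [Complex.norm_cpow_eq_rpow_re_of_pos hX, hzre]
  -- `L(3/4+iy, χ)` by Pólya–Vinogradov
  have hsre : ((1 : ℂ) + z).re = 3 / 4 := by rw [add_re, one_re, hzre]; norm_num
  have hLpv := DirichletAbel.norm_LFunction_le_polyaVinogradov_of_half_le χ hD8 hprim (s := 1 + z)
    (by rw [hsre]; norm_num) (by rw [hsre]; norm_num)
  rw [hsre, show (1 : ℝ) - 3 / 4 = 1 / 4 by norm_num] at hLpv
  have hq := sqrt_mul_rpow_quarter_le (D := D) hDpos hlog0
  have hL : ‖χ.LFunction (1 + z)‖ ≤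
      3 * Real.exp (3 / 2) * ((D : ℝ) ^ (1 / 8 : ℝ) * (1 + Real.log D) ^ 2) * (1 + |y|) := by
    calc ‖χ.LFunction (1 + z)‖
        ≤ Real.exp (3 / 2) * (Real.sqrt D * (1 + Real.log D)) ^ (1 / 4 : ℝ) * (1 + Real.log D) *
            ‖(1 : ℂ) + z‖ := hLpv
      _ ≤ Real.exp (3 / 2) * ((D : ℝ) ^ (1 / 8 : ℝ) * (1 + Real.log D)) * (1 + Real.log D) *
            (3 * (1 + |y|)) := by gcongr
      _ = _ := by ring
  have hX4 : 0 ≤ X ^ (-(1 / 4) : ℝ) := by positivity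
  have s1 : ‖riemannZeta (1 + z)‖ * ‖Complex.Gamma z‖ ≤
      (4 * 5 ^ 4 * (1 + |y|) ^ 4) * (4 * CΓ * (1 + |y|) ^ 3 * Real.exp (-(π * |y| / 2))) :=
    mul_le_mul hζ hΓ (norm_nonneg _) (by positivity)
  have s2 : ‖riemannZeta (1 + z)‖ * ‖Complex.Gamma z‖ * ‖(X : ℂ) ^ z‖ ≤
      (4 * 5 ^ 4 * (1 + |y|) ^ 4) * (4 * CΓ * (1 + |y|) ^ 3 * Real.exp (-(π * |y| / 2))) *
        X ^ (-(1 / 4) : ℝ) := by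
    rw [hXz]; exact mul_le_mul_of_nonneg_right s1 hX4
  have s3 : ‖riemannZeta (1 + z)‖ * ‖Complex.Gamma z‖ * ‖(X : ℂ) ^ z‖ * ‖χ.LFunction (1 + z)‖ ≤
      (4 * 5 ^ 4 * (1 + |y|) ^ 4) * (4 * CΓ * (1 + |y|) ^ 3 * Real.exp (-(π * |y| / 2))) *
        X ^ (-(1 / 4) : ℝ) *
        (3 * Real.exp (3 / 2) * ((D : ℝ) ^ (1 / 8 : ℝ) * (1 + Real.log D) ^ 2) * (1 + |y|)) :=
    mul_le_mul s2 hL (norm_nonneg _) (by positivity)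
  rw [F1, norm_mul, norm_mul, norm_mul]
  refine s3.trans (le_of_eq ?_)
  rw [Kline57]; ring

/-- **The shifted integral** (`χ` primitive mod `D ≥ 8`):
`‖∫ F(−1/4+iy) dy‖ ≤ 2·18⁸ · K D^{1/8} (1+𝓛)² X^{-1/4}`. [folklore] -/
theorem norm_integral_F1_line_le (hprim : χ.IsPrimitive) (hD8 : 8 ≤ D) (hX : 0 < X) :
    ‖∫ y : ℝ, F1 χ X (((-(1 / 4) : ℝ) : ℂ) + y * I)‖ ≤
      2 * 18 ^ 8 * (Kline57 * (D : ℝ) ^ (1 / 8 : ℝ) * (1 + Real.log D) ^ 2 * X ^ (-(1 / 4) : ℝ)) := by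
  set K : ℝ := Kline57 * (D : ℝ) ^ (1 / 8 : ℝ) * (1 + Real.log D) ^ 2 * X ^ (-(1 / 4) : ℝ) with hK
  have hD0 : D ≠ 0 := by omega
  have hlog0 : 0 ≤ Real.log D := Real.log_nonneg (by exact_mod_cast Nat.one_le_iff_ne_zero.2 hD0)
  have hK0 : 0 ≤ K := by rw [hK]; have := Kline57_pos; positivity
  have hbound : ∀ y : ℝ, ‖F1 χ X (((-(1 / 4) : ℝ) : ℂ) + y * I)‖ ≤
      K * ((1 + |y|) ^ 8 * Real.exp (-(π * |y| / 2))) := by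
    intro y
    have hb := norm_F1_line_le χ hprim hD8 hX y
    rw [← hK] at hb
    exact hb
  have hint := (integrable_pow_mul_exp 8).const_mul K
  calc ‖∫ y : ℝ, F1 χ X (((-(1 / 4) : ℝ) : ℂ) + y * I)‖
      ≤ ∫ y : ℝ, K * ((1 + |y|) ^ 8 * Real.exp (-(π * |y| / 2))) :=
        norm_integral_le_of_norm_le hint (Eventually.of_forall hbound)
    _ = K * ∫ y : ℝ, (1 + |y|) ^ 8 * Real.exp (-(π * |y| / 2)) := integral_const_mul _ _
    _ ≤ K * (2 * (2 * (8 : ℕ) + 2) ^ 8) := by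
        gcongr; exact integral_pow_mul_exp_le 8
    _ = 2 * 18 ^ 8 * K := by norm_num; ring

end LineBound

/-! ### §6. The residue of the double pole at `z = 0` -/

section Residue

/-- **The residue**: `((swap dslope 0)^[1] h)(0) = h′(0) = u′(0) L(1,χ) + L′(1,χ)`.
[cite: Zhang2022LandauSiegel, §5, proof of Lemma 5.7 ("equal to L′(1,χ) + o(1)")] -/
theorem residue_eq (hχ1 : χ ≠ 1) (hX : 0 < X) :
    (Function.swap dslope (0 : ℂ))^[1] (h1 χ X) 0 =
      deriv (u1 X) 0 * χ.LFunction 1 + deriv χ.LFunction 1 := by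
  show dslope (h1 χ X) 0 0 = _
  rw [dslope_same]
  have hU : {z : ℂ | -(1 / 2) < z.re} ∈ 𝓝 (0 : ℂ) := isOpen_U.mem_nhds (by simp)
  have hu : HasDerivAt (u1 X) (deriv (u1 X) 0) 0 :=
    ((differentiableOn_u1 hX).differentiableAt hU).hasDerivAt
  have hL : HasDerivAt (fun z : ℂ => χ.LFunction (1 + z)) (deriv χ.LFunction 1) 0 := by
    have h := ((DirichletCharacter.differentiable_LFunction hχ1) ((1 : ℂ) + 0)).hasDerivAt
    have h2 := h.comp_const_add 1 0
    simpa only [add_zero] using h2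
  have hprod := hu.fun_mul hL
  have hfun : h1 χ X = fun z => u1 X z * χ.LFunction (1 + z) := rfl
  rw [hfun]
  refine (hprod.congr_deriv ?_).deriv
  rw [u1_zero, add_zero, one_mul]

omit [NeZero D] in
/-- **`u` near `0`**: for `X ≥ 1` with `log X ≤ 4𝓛` (`𝓛 = log D ≥ 3`) and `‖z‖ ≤ 1/(4𝓛)`,
`‖u(z)‖ ≤ (13/4)⁴ · 2C_Γ · e`. [folklore] -/
theorem norm_u1_le (hL : 3 ≤ Real.log D) (hX1 : 1 ≤ X) (hXL : Real.log X ≤ 4 * Real.log D)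
    {z : ℂ} (hz : ‖z‖ ≤ 1 / (4 * Real.log D)) :
    ‖u1 X z‖ ≤ (13 / 4 : ℝ) ^ 4 * (2 * CΓ) * Real.exp 1 := by
  set Lg : ℝ := Real.log D with hLdef
  have hL0 : 0 < Lg := by linarith
  have hX0 : 0 < X := by linarith
  have hr9 : ‖z‖ ≤ 1 / 9 := by
    refine hz.trans ?_
    rw [div_le_div_iff₀ (by positivity) (by norm_num)]; linarith
  have hzre : |z.re| ≤ 1 / 9 := (Complex.abs_re_le_norm z).trans hr9
  have hzim : |z.im| ≤ ‖z‖ := Complex.abs_im_le_norm z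
  have h1z : ‖(1 : ℂ) + z‖ ≤ 5 / 4 := by
    have := norm_add_le (1 : ℂ) z; rw [norm_one] at this; linarith
  have hζ₁ : ‖riemannZeta₁ (1 + z)‖ ≤ (13 / 4 : ℝ) ^ 4 := by
    have h := BurnolVectors.norm_riemannZeta₁_le (s := 1 + z)
      (by rw [add_re, one_re]; have := neg_abs_le z.re; linarith)
    refine h.trans ?_
    have : ‖(1 : ℂ) + z‖ + 2 ≤ 13 / 4 := by linarith
    exact pow_le_pow_left₀ (by positivity) this 4
  have hC := CΓ_pos
  have hΓ : ‖Complex.Gamma (z + 1)‖ ≤ 2 * CΓ := by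
    have := norm_Gamma_strip_le (x := z.re + 1) (by have := neg_abs_le z.re; linarith)
      (by have := le_abs_self z.re; linarith) z.im
    have e : ((z.re + 1 : ℝ) : ℂ) + z.im * I = z + 1 := by
      rw [show ((z.re + 1 : ℝ) : ℂ) = (z.re : ℂ) + 1 by push_cast; ring]
      conv_rhs => rw [← Complex.re_add_im z]
      ring
    rw [e] at this
    refine this.trans ?_
    have hy : |z.im| ≤ 1 / 9 := hzim.trans hr9
    have hE : Real.exp (-(π * |z.im| / 2)) ≤ 1 := by
      rw [Real.exp_le_one_iff]
      have := Real.pi_pos; have := abs_nonneg z.im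
      nlinarith
    calc CΓ * (1 + |z.im|) ^ 3 * Real.exp (-(π * |z.im| / 2))
        ≤ CΓ * (1 + 1 / 9) ^ 3 * 1 := by gcongr
      _ ≤ 2 * CΓ := by nlinarith
  have hXz : ‖(X : ℂ) ^ z‖ ≤ Real.exp 1 := by
    rw [Complex.norm_cpow_eq_rpow_re_of_pos hX0, Real.rpow_def_of_pos hX0, Real.exp_le_exp]
    have hlogX : 0 ≤ Real.log X := Real.log_nonneg hX1
    calc Real.log X * z.re ≤ Real.log X * ‖z‖ :=
          mul_le_mul_of_nonneg_left ((le_abs_self _).trans (Complex.abs_re_le_norm z)) hlogX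
      _ ≤ (4 * Lg) * (1 / (4 * Lg)) := mul_le_mul hXL hz (norm_nonneg _) (by positivity)
      _ = 1 := by field_simp
  rw [u1, norm_mul, norm_mul]
  have s1 : ‖riemannZeta₁ (1 + z)‖ * ‖Complex.Gamma (z + 1)‖ ≤ (13 / 4 : ℝ) ^ 4 * (2 * CΓ) :=
    mul_le_mul hζ₁ hΓ (norm_nonneg _) (by positivity)
  exact mul_le_mul s1 hXz (norm_nonneg _) (by positivity)

omit [NeZero D] in
/-- **Cauchy's estimate for `u′(0)`** on `|z| = 1/(4𝓛)`:
`‖u′(0)‖ ≤ (13/4)⁴·2C_Γ·e · 4𝓛`. [folklore] -/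
theorem norm_deriv_u1_le (hL : 3 ≤ Real.log D) (hX1 : 1 ≤ X) (hXL : Real.log X ≤ 4 * Real.log D) :
    ‖deriv (u1 X) 0‖ ≤ (13 / 4 : ℝ) ^ 4 * (2 * CΓ) * Real.exp 1 / (1 / (4 * Real.log D)) := by
  set r : ℝ := 1 / (4 * Real.log D) with hr
  have hL0 : 0 < Real.log D := by linarith
  have hr0 : 0 < r := by positivity
  have hX0 : 0 < X := by linarith
  have hd : DiffContOnCl ℂ (u1 X) (ball 0 r) := by
    refine (differentiableOn_u1 hX0).diffContOnCl_ball fun z hz => ?_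
    rw [mem_closedBall, dist_zero_right] at hz
    simp only [mem_setOf_eq]
    have := Complex.abs_re_le_norm z
    have := neg_abs_le z.re
    have hr9 : r ≤ 1 / 9 := by
      rw [hr, div_le_div_iff₀ (by positivity) (by norm_num)]; linarith
    linarith
  have hM : ∀ z ∈ sphere (0 : ℂ) r, ‖u1 X z‖ ≤ (13 / 4 : ℝ) ^ 4 * (2 * CΓ) * Real.exp 1 := by
    intro z hz
    rw [mem_sphere, dist_zero_right] at hz
    exact norm_u1_le (D := D) hL hX1 hXL (by rw [hz])
  exact Complex.norm_deriv_le_of_forall_mem_sphere_norm_le hr0 hd hM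

end Residue

/-! ### §7. The explicit formula and the assembly -/

section Assembly

/-- **The explicit formula**: for `χ ≠ 1`, `X > 0`,
`2π W_ν(X) = 2π · (u′(0)L(1,χ) + L′(1,χ)) + ∫ F(−1/4+iy) dy`.
[cite: Zhang2022LandauSiegel, §5, proof of Lemma 5.7] -/
theorem W_eq_residue_add (hχ1 : χ ≠ 1) (hX : 0 < X) :
    2 * (π : ℂ) * W (fun n => divisorSumChar χ n) X =
      2 * π * (deriv (u1 X) 0 * χ.LFunction 1 + deriv χ.LFunction 1) +
        ∫ t : ℝ, F1 χ X ((((-(1 / 4) : ℝ)) : ℂ) + t * I) := by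
  set U : Set ℂ := {z : ℂ | -(1 / 2) < z.re} with hU
  have hUo : IsOpen U := isOpen_U
  have hstrip := Literature.Analysis.Complex.integral_vertical_sub_eq_sum_of_poles_dslope
    (F := F1 χ X) (σ₁ := -(1 / 4)) (κ := 2) (by norm_num) ({0} : Finset ℂ) (fun _ => 1)
    (fun _ => h1 χ X) U hUo
    (fun z hz => by
      simp only [mem_preimage, mem_Icc] at hz
      show -(1 / 2) < z.re
      linarith [hz.1])
    (fun p hp => by rw [Finset.mem_singleton] at hp; rw [hp]; simp)
    (by rw [Finset.coe_singleton]; exact differentiableOn_F1 χ hχ1 hX)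
    (fun p hp => by
      rw [Finset.mem_singleton] at hp
      subst hp
      refine ⟨U, hUo.mem_nhds (by simp [hU]), differentiableOn_h1 χ hχ1 hX,
        fun z hz hz0 => ?_⟩
      refine F1_eq_h1_div χ hz0 fun m hm => ?_
      have hzre : -(1 / 2) < z.re := hz
      rw [hm] at hzre hz0
      simp at hzre
      have : m = 0 := by
        by_contra h
        have : (1 : ℝ) ≤ m := by exact_mod_cast Nat.one_le_iff_ne_zero.2 h
        linarith
      subst this
      simp at hz0)
    (integrable_F1_line χ hχ1 hX (Or.inr rfl))
    (integrable_F1_line χ hχ1 hX (Or.inl rfl))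
    (F1_horizontal_decay χ hχ1 hX)
  rw [Finset.sum_singleton, residue_eq χ hχ1 hX] at hstrip
  have h2 := (integral_F1_line_two χ hX).2
  have e2 : (∫ t : ℝ, F1 χ X (((2 : ℝ) : ℂ) + t * I)) = ∫ t : ℝ, F1 χ X (2 + t * I) := by
    norm_num
  rw [e2, h2] at hstrip
  exact sub_eq_iff_eq_add.1 hstrip

/-- **Lemma 5.7 with explicit main term and error**: there is an absolute `C` such that for `χ`
primitive quadratic mod `D`, `log D ≥ 3`, (A) `‖L(1,χ)‖ ≤ 𝓛^{-2022}`: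
`Re L′(1,χ) ≥ e^{-1} ∑_{n∣D} 1/n − C 𝓛^{-2011}`. [cite: Zhang2022LandauSiegel, §5, Lemma 5.7] -/
theorem re_deriv_LFunction_one_ge : ∃ C : ℝ, ∀ (D : ℕ) [NeZero D] (χ : DirichletCharacter ℂ D),
    χ.IsPrimitive → χ ^ 2 = 1 → 3 ≤ Real.log D →
    ‖χ.LFunction 1‖ ≤ 1 / Real.log D ^ 2022 →
      Real.exp (-1) * ∑ n ∈ D.divisors, (1 : ℝ) / n - C / Real.log D ^ 2011 ≤
        (deriv χ.LFunction 1).re := by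
  refine ⟨4 * ((13 / 4 : ℝ) ^ 4 * (2 * CΓ) * Real.exp 1) +
    2 * 18 ^ 8 * Kline57 * (8 * 4028 ^ 2014), ?_⟩
  intro D _ χ hprim hχ2 hL hA
  set M : ℝ := (4028 : ℝ) ^ 2014 with hM
  clear_value M
  set M' : ℝ := (18 : ℝ) ^ 8 with hM'
  clear_value M'
  set Mu : ℝ := (13 / 4 : ℝ) ^ 4 * (2 * CΓ) * Real.exp 1 with hMu
  set Lg : ℝ := Real.log D with hLdef
  have hL1 : 1 ≤ Lg := by linarith
  have hL0 : 0 < Lg := by linarith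
  have hD0 : D ≠ 0 := by
    rintro rfl; simp [hLdef] at hL; linarith
  have hDpos : (0 : ℝ) < D := by exact_mod_cast Nat.pos_of_ne_zero hD0
  have hD8 : 8 ≤ D := by
    have h1 : Real.exp 3 ≤ Real.exp Lg := Real.exp_le_exp.2 hL
    rw [hLdef, Real.exp_log hDpos] at h1
    have := eight_lt_exp_three
    exact_mod_cast (show (8 : ℝ) ≤ D by linarith)
  have hD1 : (1 : ℝ) ≤ D := by exact_mod_cast Nat.one_le_iff_ne_zero.2 hD0
  have hχ1 := ne_one_of_isPrimitive χ (by omega) hprim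
  -- `X = D⁴`
  set X : ℝ := (D : ℝ) ^ 4 with hXdef
  have hXpos : 0 < X := by positivity
  have hX1 : 1 ≤ X := one_le_pow₀ hD1
  have hXL : Real.log X ≤ 4 * Real.log D := by rw [hXdef, Real.log_pow]; push_cast; exact le_rfl
  have hDX : (D : ℝ) ≤ X := by
    calc (D : ℝ) = D ^ 1 := (pow_one _).symm
      _ ≤ D ^ 4 := pow_le_pow_right₀ hD1 (by norm_num)
  -- the explicit formula and the lower bound
  have hW := W_eq_residue_add χ hχ1 hXpos
  have hlow := re_W_nu_ge χ hχ2 hXpos hDX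
  set Iline : ℂ := ∫ t : ℝ, F1 χ X ((((-(1 / 4) : ℝ)) : ℂ) + t * I) with hIline
  have hπ0 : (π : ℂ) ≠ 0 := ofReal_ne_zero.2 Real.pi_pos.ne'
  have hWeq : W (fun n => divisorSumChar χ n) X =
      (deriv (u1 X) 0 * χ.LFunction 1 + deriv χ.LFunction 1) + (1 / (2 * π)) * Iline := by
    field_simp
    linear_combination hW
  -- the two error terms
  have hu := norm_deriv_u1_le (D := D) hL hX1 hXL
  rw [← hMu, ← hLdef] at hu
  have e1 : Mu / (1 / (4 * Lg)) = 4 * Mu * Lg := by field_simp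
  rw [e1] at hu
  have hMu0 : 0 ≤ Mu := by rw [hMu]; have := CΓ_pos; positivity
  have hT1 : ‖deriv (u1 X) 0 * χ.LFunction 1‖ ≤ 4 * Mu / Lg ^ 2011 := by
    rw [norm_mul]
    calc ‖deriv (u1 X) 0‖ * ‖χ.LFunction 1‖ ≤ (4 * Mu * Lg) * (1 / Lg ^ 2022) :=
          mul_le_mul hu hA (norm_nonneg _) (by positivity)
      _ = 4 * Mu / Lg ^ 2011 * (1 / Lg ^ 10) := by field_simp
      _ ≤ 4 * Mu / Lg ^ 2011 * 1 := by
          gcongr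
          rw [div_le_one (by positivity)]; exact one_le_pow₀ hL1
      _ = 4 * Mu / Lg ^ 2011 := by ring
  have hlp := aux_logpow (D := D) hL1 hDpos
  rw [← hLdef, ← hM] at hlp
  have hT2 : ‖(1 / (2 * (π : ℂ))) * Iline‖ ≤ 2 * M' * Kline57 * (8 * M) / Lg ^ 2011 := by
    rw [norm_mul]
    have hπ1 : ‖(1 / (2 * (π : ℂ)))‖ ≤ 1 := by
      rw [norm_div, norm_one, norm_mul, Complex.norm_ofNat, Complex.norm_real, Real.norm_eq_abs,
        abs_of_pos Real.pi_pos, div_le_one (by positivity)]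
      linarith [Real.pi_gt_three]
    have hI := norm_integral_F1_line_le χ hprim hD8 hXpos
    rw [← hIline, ← hM', ← hLdef] at hI
    set t : ℝ := (D : ℝ) ^ (1 / 8 : ℝ) with htdef
    have ht0 : 0 < t := by positivity
    have ht1 : 1 ≤ t := by rw [htdef]; exact Real.one_le_rpow hD1 (by norm_num)
    have ht4 : (D : ℝ) ^ (1 / 2 : ℝ) = t ^ 4 := by
      rw [htdef, ← Real.rpow_natCast, ← Real.rpow_mul hDpos.le]; norm_num
    have ht8 : (D : ℝ) = t ^ 8 := by
      rw [htdef, ← Real.rpow_natCast, ← Real.rpow_mul hDpos.le]; norm_num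
    have hX4 : X ^ (-(1 / 4) : ℝ) = 1 / t ^ 8 := by
      have e8 : (1 : ℝ) / t ^ 8 = t ^ (-(8 : ℝ)) := by
        rw [Real.rpow_neg ht0.le, ← Real.rpow_natCast t 8, one_div]; norm_num
      rw [e8, hXdef, ht8, ← pow_mul, ← Real.rpow_natCast, ← Real.rpow_mul ht0.le]
      norm_num
    rw [ht4] at hlp
    have hK := Kline57_pos
    have hM'0 : 0 ≤ M' := by rw [hM']; positivity
    have h8M : 0 ≤ 8 * M / Lg ^ 2011 := by rw [hM]; positivity
    have h1t : 1 / t ^ 3 ≤ 1 := by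
      rw [div_le_one (by positivity)]; exact one_le_pow₀ ht1
    have h23 : (1 + Lg) ^ 2 ≤ (1 + Lg) ^ 3 := pow_le_pow_right₀ (by linarith) (by norm_num)
    have hmain : Kline57 * (D : ℝ) ^ (1 / 8 : ℝ) * (1 + Lg) ^ 2 * X ^ (-(1 / 4) : ℝ) ≤
        Kline57 * (8 * M / Lg ^ 2011) := by
      calc Kline57 * (D : ℝ) ^ (1 / 8 : ℝ) * (1 + Lg) ^ 2 * X ^ (-(1 / 4) : ℝ)
          ≤ Kline57 * t * (1 + Lg) ^ 3 * (1 / t ^ 8) := by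
            rw [hX4, ← htdef]; gcongr
        _ = Kline57 * ((1 + Lg) ^ 3 / t ^ 4 * (1 / t ^ 3)) := by
            field_simp
        _ ≤ Kline57 * (8 * M / Lg ^ 2011 * 1) := by
            refine mul_le_mul_of_nonneg_left ?_ hK.le
            exact mul_le_mul hlp h1t (by positivity) h8M
        _ = Kline57 * (8 * M / Lg ^ 2011) := by ring
    calc ‖(1 / (2 * (π : ℂ)))‖ * ‖Iline‖
        ≤ 1 * (2 * M' * (Kline57 * (D : ℝ) ^ (1 / 8 : ℝ) * (1 + Lg) ^ 2 * X ^ (-(1 / 4) : ℝ))) :=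
          mul_le_mul hπ1 hI (norm_nonneg _) (by norm_num)
      _ ≤ 1 * (2 * M' * (Kline57 * (8 * M / Lg ^ 2011))) := by gcongr
      _ = 2 * M' * Kline57 * (8 * M) / Lg ^ 2011 := by ring
  -- combine: Re W = Re L′ + Re (u′(0)L(1,χ)) + Re ((1/2π)∫)
  have hre : (W (fun n => divisorSumChar χ n) X).re =
      (deriv χ.LFunction 1).re + (deriv (u1 X) 0 * χ.LFunction 1).re +
        ((1 / (2 * (π : ℂ))) * Iline).re := by
    rw [hWeq]; simp only [add_re]; ring
  have hb1 : (deriv (u1 X) 0 * χ.LFunction 1).re ≤ 4 * Mu / Lg ^ 2011 :=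
    (Complex.re_le_norm _).trans hT1
  have hb2 : ((1 / (2 * (π : ℂ))) * Iline).re ≤ 2 * M' * Kline57 * (8 * M) / Lg ^ 2011 :=
    (Complex.re_le_norm _).trans hT2
  rw [hLdef] at hb1 hb2 ⊢
  have : (4 * Mu + 2 * M' * Kline57 * (8 * M)) / Real.log D ^ 2011 =
      4 * Mu / Real.log D ^ 2011 + 2 * M' * Kline57 * (8 * M) / Real.log D ^ 2011 := by ring
  rw [hMu] at this hb1
  rw [this]
  linarith

/-- **Zhang (2022), Lemma 5.7, divisor-sum form, kernel-checked**: there is `L₀` such that for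
every `D` with `log D ≥ L₀` and every PRIMITIVE quadratic `χ` mod `D` satisfying (A)
`‖L(1,χ)‖ ≤ (log D)^{-2022}`, `Re L′(1,χ) ≥ (2e)^{-1} ∑_{n∣D} 1/n` (and `L′(1,χ)` is real,
`ExceptionalZero.deriv_LFunction_ofReal_im_eq_zero`).
[cite: Zhang2022LandauSiegel, §5, Lemma 5.7 ("≫ ∑_{n∣D} 1/n")] -/
theorem lemma_5_7_divisors : ∃ L₀ : ℝ, ∀ (D : ℕ) [NeZero D] (χ : DirichletCharacter ℂ D),
    χ.IsPrimitive → χ ^ 2 = 1 → L₀ ≤ Real.log D →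
    ‖χ.LFunction 1‖ ≤ 1 / Real.log D ^ 2022 →
      Real.exp (-1) / 2 * ∑ n ∈ D.divisors, (1 : ℝ) / n ≤ (deriv χ.LFunction 1).re := by
  obtain ⟨C, hC⟩ := re_deriv_LFunction_one_ge
  -- choose `L₀ ≥ 3` with `C/L₀^{2011} ≤ e^{-1}/2`; since `L₀^{2011} ≥ L₀`, `L₀ = max 3 (2|C|e)` works
  refine ⟨max 3 (2 * |C| * Real.exp 1 + 1), ?_⟩
  intro D _ χ hprim hχ2 hL hA
  have hL3 : 3 ≤ Real.log D := le_trans (le_max_left _ _) hL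
  have hLC : 2 * |C| * Real.exp 1 + 1 ≤ Real.log D := le_trans (le_max_right _ _) hL
  have hD0 : D ≠ 0 := by
    rintro rfl; simp at hL3; linarith
  have h := hC D χ hprim hχ2 hL3 hA
  have hS1 := one_le_sum_divisors (D := D) hD0
  set S : ℝ := ∑ n ∈ D.divisors, (1 : ℝ) / n
  have hL1 : 1 ≤ Real.log D := by linarith
  have hpow : Real.log D ≤ Real.log D ^ 2011 := by
    calc Real.log D = Real.log D ^ 1 := (pow_one _).symm
      _ ≤ Real.log D ^ 2011 := pow_le_pow_right₀ hL1 (by norm_num)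
  have hE := Real.exp_pos (1 : ℝ)
  have hE1 : Real.exp (-1) * Real.exp 1 = 1 := by rw [← Real.exp_add]; norm_num
  -- `C/𝓛^{2011} ≤ |C|/𝓛 ≤ e^{-1}/2`
  have hCb : C / Real.log D ^ 2011 ≤ Real.exp (-1) / 2 := by
    have h1 : C / Real.log D ^ 2011 ≤ |C| / Real.log D := by
      calc C / Real.log D ^ 2011 ≤ |C| / Real.log D ^ 2011 :=
            div_le_div_of_nonneg_right (le_abs_self C) (by positivity)
        _ ≤ |C| / Real.log D := div_le_div_of_nonneg_left (abs_nonneg C) (by positivity) hpow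
    refine h1.trans ?_
    rw [div_le_div_iff₀ (by positivity) (by norm_num)]
    have hC0 := abs_nonneg C
    nlinarith
  have hq : 0 ≤ Real.exp (-1) := (Real.exp_pos _).le
  nlinarith

/-- **Zhang (2022), Lemma 5.7 as printed, kernel-checked**: there is `L₀` such that for every `D`
with `log D ≥ L₀` and every PRIMITIVE quadratic `χ` mod `D` satisfying (A)
`‖L(1,χ)‖ ≤ (log D)^{-2022}`, `Re L′(1,χ) ≥ (4e)^{-1} · D/φ(D)`.
[cite: Zhang2022LandauSiegel, §5, Lemma 5.7 ("L′(1,χ) ≫ D/φ(D)")] -/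
theorem lemma_5_7 : ∃ L₀ : ℝ, ∀ (D : ℕ) [NeZero D] (χ : DirichletCharacter ℂ D),
    χ.IsPrimitive → χ ^ 2 = 1 → L₀ ≤ Real.log D →
    ‖χ.LFunction 1‖ ≤ 1 / Real.log D ^ 2022 →
      Real.exp (-1) / 4 * ((D : ℝ) / Nat.totient D) ≤ (deriv χ.LFunction 1).re := by
  obtain ⟨L₀, hL₀⟩ := lemma_5_7_divisors
  refine ⟨max L₀ 1, fun D _ χ hprim hχ2 hL hA => ?_⟩
  have hD0 : D ≠ 0 := by
    rintro rfl
    have : (1 : ℝ) ≤ Real.log ((0 : ℕ) : ℝ) := le_trans (le_max_right _ _) hL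
    simp at this; linarith
  have h := hL₀ D χ hprim hχ2 (le_trans (le_max_left _ _) hL) hA
  have harith := half_self_div_totient_le_sum_divisors (D := D) hD0
  have hq : 0 ≤ Real.exp (-1) := (Real.exp_pos _).le
  nlinarith

/-- **`𝔞 ≫ 1` under (A)** (the source, §2: "It can be shown that the assumption (A) implies 𝔞 ≫ 1
(see Lemma 5.7)"): there is `L₀` such that for `log D ≥ L₀`, `χ` primitive quadratic mod `D` with
(A), `(6/π²) L′(1,χ)² ∏_{q∣D} q/(q+1) ≥ 3/(2e²π²)`
(`L′(1,χ) ≥ (2e)^{-1}∑_{n∣D}1/n ≥ (2e)^{-1}∏_{p∣D}(1+1/p)` and `∏ q/(q+1) = (∏(1+1/p))^{-1}`).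
[cite: Zhang2022LandauSiegel, §2 (after (2.31)); §5, Lemma 5.7] -/
theorem frakA_ge : ∃ L₀ : ℝ, ∀ (D : ℕ) [NeZero D] (χ : DirichletCharacter ℂ D),
    χ.IsPrimitive → χ ^ 2 = 1 → L₀ ≤ Real.log D →
    ‖χ.LFunction 1‖ ≤ 1 / Real.log D ^ 2022 →
      3 / (2 * Real.exp 1 ^ 2 * π ^ 2) ≤
        6 / π ^ 2 * (deriv χ.LFunction 1).re ^ 2 * ∏ p ∈ D.primeFactors, ((p : ℝ) / (p + 1)) := by
  obtain ⟨L₀, hL₀⟩ := lemma_5_7_divisors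
  refine ⟨max L₀ 1, fun D _ χ hprim hχ2 hL hA => ?_⟩
  have hD0 : D ≠ 0 := by
    rintro rfl
    have : (1 : ℝ) ≤ Real.log ((0 : ℕ) : ℝ) := le_trans (le_max_right _ _) hL
    simp at this; linarith
  have h := hL₀ D χ hprim hχ2 (le_trans (le_max_left _ _) hL) hA
  set P : ℝ := ∏ p ∈ D.primeFactors, (1 + (1 : ℝ) / p) with hP
  have hP1 : 1 ≤ P := by
    rw [hP]
    exact Finset.one_le_prod fun p hp => by
      have : 0 ≤ (1 : ℝ) / p := by positivity
      linarith
  have hPS : P ≤ ∑ n ∈ D.divisors, (1 : ℝ) / n := prod_one_add_inv_le_sum_divisors hD0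
  have hprod : (∏ p ∈ D.primeFactors, ((p : ℝ) / (p + 1))) * P = 1 := by
    rw [hP, ← Finset.prod_mul_distrib]
    refine Finset.prod_eq_one fun p hp => ?_
    have hp0 : (p : ℝ) ≠ 0 := by exact_mod_cast (Nat.prime_of_mem_primeFactors hp).ne_zero
    have hp1 : (p : ℝ) + 1 ≠ 0 := by positivity
    field_simp
  have hprod' : ∏ p ∈ D.primeFactors, ((p : ℝ) / (p + 1)) = 1 / P :=
    eq_one_div_of_mul_eq_one_left hprod
  rw [hprod']
  set Lr : ℝ := (deriv χ.LFunction 1).re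
  have hP0 : 0 < P := by linarith
  have hq : 0 ≤ Real.exp (-1) / 2 := by positivity
  have hcP : Real.exp (-1) / 2 * P ≤ Lr :=
    le_trans (mul_le_mul_of_nonneg_left hPS hq) h
  have hcP0 : 0 ≤ Real.exp (-1) / 2 * P := by positivity
  have hE : Real.exp (-1) = (Real.exp 1)⁻¹ := Real.exp_neg 1
  have hE0 : 0 < Real.exp 1 := Real.exp_pos 1
  calc 3 / (2 * Real.exp 1 ^ 2 * π ^ 2) = 6 / π ^ 2 * (Real.exp (-1) / 2) ^ 2 * 1 := by
        rw [hE]; field_simp; ring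
    _ ≤ 6 / π ^ 2 * (Real.exp (-1) / 2) ^ 2 * P := by gcongr
    _ = 6 / π ^ 2 * (Real.exp (-1) / 2 * P) ^ 2 * (1 / P) := by
        field_simp
    _ ≤ 6 / π ^ 2 * Lr ^ 2 * (1 / P) := by gcongr

/-- The same for the tree's `𝔞 = Lemma171.frakA χ` ((2.31), `Section17Lemma171.lean`):
under (A) and `log D ≥ L₀`, `𝔞 ≥ 3/(2e²π²)`. [cite: Zhang2022LandauSiegel, §2 (after (2.31))] -/
theorem frakA_ge' : ∃ L₀ : ℝ, ∀ (D : ℕ) [NeZero D] (χ : DirichletCharacter ℂ D),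
    χ.IsPrimitive → χ ^ 2 = 1 → L₀ ≤ Real.log D →
    ‖χ.LFunction 1‖ ≤ 1 / Real.log D ^ 2022 →
      3 / (2 * Real.exp 1 ^ 2 * π ^ 2) ≤ Lemma171.frakA χ := by
  obtain ⟨L₀, hL₀⟩ := frakA_ge
  exact ⟨L₀, fun D _ χ hprim hχ2 hL hA => by
    rw [Lemma171.frakA_def]; exact hL₀ D χ hprim hχ2 hL hA⟩

end Assembly

end Literature.NumberTheory.LFunctions.Zhang2022.Lemma57

end
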